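import Mathlib.Analysis.Complex.CauchyIntegral
import Mathlib.MeasureTheory.Integral.IntervalIntegral.Periodic
import Mathlib.MeasureTheory.Integral.Pi
import Mathlib.MeasureTheory.Function.LocallyIntegrable
import Summits.HubbardSuperconductivity.HubbardSuperconductivity.Theorems.BirComplexStableXY.Negative.WitnessTable

/-!
# Iterated contour shift on the torus `[0,2π]^Λ`
(`BalabanIR.BirComplexStableXY`, stmt-HubbardSuperconductivity-2080, line `theta-rotor-equimodular-zeros`, S2a-i)

The complex-analysis engine of the global gauge identity for partition functions
`Z = ∫_cube e^{-A(θ)} dθ` of lattice models with an entire, `2π`-periodic action: for an integrand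
`G : ℂ^ι → ℂ` that is continuous, entire in each coordinate separately (at every complex base point) and
`2π`-periodic in each coordinate separately, the integral of `θ ↦ G θ` over the real torus `[0,2π]^ι` is
invariant under translating every coordinate by an arbitrary COMPLEX constant `c : ι → ℂ`:
`∫_{[0,2π]^ι} G(θ + c) dθ = ∫_{[0,2π]^ι} G(θ) dθ`.

Proof.  ONE VARIABLE (`intervalIntegral_comp_add_of_periodic_entire`): Cauchy's theorem on the rectangle
`[0,2π] × [0, Im a]` (`Complex.integral_boundary_rect_eq_zero_of_differentiableOn`), whose two vertical
sides cancel by periodicity, followed by the real shift by `Re a` (`Function.Periodic.intervalIntegral_add_eq`).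
MANY VARIABLES (`integral_pi_Icc_comp_add_complex_fin`, index type `Fin n`, induction on `n`): the cube
measure is the product measure `Measure.pi` of the restricted Lebesgue measures; peel off coordinate `0`
with the measure-preserving `MeasurableEquiv.piFinSuccAbove`, use Fubini (`MeasureTheory.integral_prod`,
all integrands are continuous on a compact cube, hence integrable), remove the shift of the remaining
coordinates by the induction hypothesis applied to the sections `w ↦ G (Fin.cons t w)` (for every fixed
complex `t`), swap the order of integration and remove the shift of coordinate `0` by the one-variable
lemma applied to the sections `s ↦ G (Fin.cons s w)`.  A general finite index type is transported to
`Fin n` along `MeasurableEquiv.piCongrLeft` (`integral_pi_Icc_comp_add_complex`), and the registered stub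
`stub_cube_contour_shift` is the special case `ι = Λ L M`, `cube L M = Set.pi univ (fun _ ↦ Icc 0 (2π))`.
No definitions, no hypotheses beyond the registered signature.
-/

namespace Summit.HubbardSuperconductivity.BirComplexStableXYNegative

open scoped BigOperators
open MeasureTheory Literature.Probability.LatticeModels

noncomputable section

/-! ### One variable: Cauchy on a rectangle and periodicity -/

-- adapted from Cruxes/BirComplexStableXY/Disproof.lean §3e (`intervalIntegral_comp_add_of_periodic_entire`)
/-- ONE VARIABLE.  Shifting the integration segment `[0,2π]` of an entire `2π`-periodic function
`h : ℂ → ℂ` by an arbitrary complex number `a` does not change the integral: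
`∫_0^{2π} h(v + a) dv = ∫_0^{2π} h(v) dv` (Cauchy's theorem on the rectangle `[0,2π] × [0, Im a]`, the
vertical sides cancel by periodicity; then the real shift by `Re a`). -/
theorem intervalIntegral_comp_add_of_periodic_entire (h : ℂ → ℂ) (hd : Differentiable ℂ h)
    (hp : ∀ z : ℂ, h (z + 2 * Real.pi) = h z) (a : ℂ) :
    ∫ v in (0:ℝ)..2 * Real.pi, h ((v : ℂ) + a) = ∫ v in (0:ℝ)..2 * Real.pi, h v := by
  -- vertical shift by `a.im`: Cauchy's theorem on the rectangle [0, 2π] × [0, a.im]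
  have hrect := Complex.integral_boundary_rect_eq_zero_of_differentiableOn h 0
    (2 * Real.pi + a.im * Complex.I) hd.differentiableOn
  have hre : (2 * (Real.pi : ℂ) + (a.im : ℂ) * Complex.I).re = 2 * Real.pi := by simp
  have him : (2 * (Real.pi : ℂ) + (a.im : ℂ) * Complex.I).im = a.im := by simp
  simp only [Complex.zero_re, Complex.zero_im, hre, him, Complex.ofReal_zero, zero_mul, add_zero,
    zero_add] at hrect
  -- the two vertical sides coincide by periodicity
  have hvert : (fun y : ℝ => h (((2 * Real.pi : ℝ) : ℂ) + y * Complex.I)) =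
      fun y : ℝ => h (y * Complex.I) := by
    funext y
    have := hp (y * Complex.I)
    rw [← this]
    congr 1
    push_cast
    ring
  have hvert' : ∫ y : ℝ in (0:ℝ)..a.im, h (↑(2 * Real.pi) + ↑y * Complex.I) =
      ∫ y : ℝ in (0:ℝ)..a.im, h (↑y * Complex.I) := by
    rw [show (fun y : ℝ => h (↑(2 * Real.pi) + ↑y * Complex.I)) =
      (fun y : ℝ => h (((2 * Real.pi : ℝ) : ℂ) + y * Complex.I)) from rfl, hvert]
  have hA : ∫ x : ℝ in (0:ℝ)..2 * Real.pi, h (↑x + ↑a.im * Complex.I) =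
      ∫ x : ℝ in (0:ℝ)..2 * Real.pi, h ↑x := by
    have e1 := hrect
    rw [hvert'] at e1
    have e2 : (∫ x : ℝ in (0:ℝ)..2 * Real.pi, h ↑x) -
        (∫ x : ℝ in (0:ℝ)..2 * Real.pi, h (↑x + ↑a.im * Complex.I)) = 0 := by
      simpa using e1
    exact (sub_eq_zero.1 e2).symm
  -- horizontal shift by `a.re`: periodicity of the real trace
  have hper : Function.Periodic (fun t : ℝ => h ((t : ℂ) + a.im * Complex.I)) (2 * Real.pi) := by
    intro t
    have := hp ((t : ℂ) + a.im * Complex.I)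
    dsimp only
    rw [← this]
    congr 1
    push_cast
    ring
  have hB : ∫ v in (0:ℝ)..2 * Real.pi, h ((v : ℂ) + a) =
      ∫ t in a.re..a.re + 2 * Real.pi, h ((t : ℂ) + a.im * Complex.I) := by
    have hsub := intervalIntegral.integral_comp_add_right (a := (0:ℝ)) (b := 2 * Real.pi)
      (fun t : ℝ => h ((t : ℂ) + a.im * Complex.I)) a.re
    simp only [zero_add] at hsub
    rw [show a.re + 2 * Real.pi = 2 * Real.pi + a.re by ring, ← hsub]
    refine intervalIntegral.integral_congr fun v _ => ?_
    show h ((v : ℂ) + a) = h (((v + a.re : ℝ) : ℂ) + a.im * Complex.I)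
    congr 1
    conv_lhs => rw [← Complex.re_add_im a]
    push_cast
    ring
  rw [hB, hper.intervalIntegral_add_eq a.re 0, zero_add, hA]

/-- ONE VARIABLE, set-integral form: for an entire `2π`-periodic `h : ℂ → ℂ` and any complex `a`,
`∫_{[0,2π]} h(v + a) dv = ∫_{[0,2π]} h(v) dv` (Lebesgue measure restricted to `Icc 0 (2π)`). -/
theorem setIntegral_Icc_comp_add_of_periodic_entire (h : ℂ → ℂ) (hd : Differentiable ℂ h)
    (hp : ∀ z : ℂ, h (z + 2 * Real.pi) = h z) (a : ℂ) :
    ∫ v in Set.Icc (0:ℝ) (2 * Real.pi), h ((v : ℂ) + a) =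
      ∫ v in Set.Icc (0:ℝ) (2 * Real.pi), h v := by
  rw [integral_Icc_eq_integral_Ioc, integral_Icc_eq_integral_Ioc,
    ← intervalIntegral.integral_of_le Real.two_pi_pos.le,
    ← intervalIntegral.integral_of_le Real.two_pi_pos.le]
  exact intervalIntegral_comp_add_of_periodic_entire h hd hp a

/-! ### Many variables: the cube measure as a product measure, integrability -/

/-- `Measure.pi` of the Lebesgue measures restricted to `[0,2π]` is the Lebesgue measure of `ℝ^ι`
restricted to the cube `[0,2π]^ι`. -/
theorem pi_restrict_Icc_eq_restrict_pi (ι : Type*) [Fintype ι] :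
    Measure.pi (fun _ : ι => (volume : Measure ℝ).restrict (Set.Icc (0:ℝ) (2 * Real.pi))) =
      (volume : Measure (ι → ℝ)).restrict (Set.pi Set.univ fun _ => Set.Icc (0:ℝ) (2 * Real.pi)) := by
  rw [volume_pi, Measure.restrict_pi_pi]

/-- A continuous function on `ℝ^ι` is integrable for the cube measure (compact cube, finite measure). -/
theorem integrable_pi_Icc_of_continuous {ι : Type*} [Fintype ι] {F : (ι → ℝ) → ℂ}
    (hF : Continuous F) :
    Integrable F (Measure.pi fun _ : ι => (volume : Measure ℝ).restrict (Set.Icc (0:ℝ) (2 * Real.pi))) := by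
  rw [pi_restrict_Icc_eq_restrict_pi]
  exact hF.continuousOn.integrableOn_compact (isCompact_univ_pi fun _ => isCompact_Icc)

/-- A continuous function on `ℝ × ℝ^n` is integrable for the product of the interval measure on
`[0,2π]` with the cube measure on `[0,2π]^n`. -/
theorem integrable_prod_pi_Icc_of_continuous {n : ℕ} {F : ℝ × (Fin n → ℝ) → ℂ}
    (hF : Continuous F) :
    Integrable F (((volume : Measure ℝ).restrict (Set.Icc (0:ℝ) (2 * Real.pi))).prod
      (Measure.pi fun _ : Fin n => (volume : Measure ℝ).restrict (Set.Icc (0:ℝ) (2 * Real.pi)))) := by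
  rw [pi_restrict_Icc_eq_restrict_pi, Measure.prod_restrict, ← Measure.volume_eq_prod]
  exact hF.continuousOn.integrableOn_compact
    (isCompact_Icc.prod (isCompact_univ_pi fun _ => isCompact_Icc))

/-! ### Many variables indexed by `Fin n`: induction, one coordinate at a time -/

/-- ITERATED CONTOUR SHIFT on `[0,2π]^n` (coordinates indexed by `Fin n`).  For `G : ℂ^n → ℂ`
continuous, entire in each coordinate separately and `2π`-periodic in each coordinate separately,
`∫_{[0,2π]^n} G(θ + c) dθ = ∫_{[0,2π]^n} G(θ) dθ` for every complex shift vector `c`. -/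
theorem integral_pi_Icc_comp_add_complex_fin (n : ℕ) :
    ∀ (G : (Fin n → ℂ) → ℂ) (c : Fin n → ℂ), Continuous G →
      (∀ (z : Fin n → ℂ) (i : Fin n), Differentiable ℂ (fun t : ℂ => G (Function.update z i t))) →
      (∀ (z : Fin n → ℂ) (i : Fin n), G (Function.update z i (z i + 2 * Real.pi)) = G z) →
      ∫ θ, G (fun i => (θ i : ℂ) + c i)
          ∂(Measure.pi fun _ : Fin n => (volume : Measure ℝ).restrict (Set.Icc (0:ℝ) (2 * Real.pi))) =
        ∫ θ, G (fun i => (θ i : ℂ))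
          ∂(Measure.pi fun _ : Fin n => (volume : Measure ℝ).restrict (Set.Icc (0:ℝ) (2 * Real.pi))) := by
  induction n with
  | zero =>
    intro G c _ _ _
    congr 1
    funext θ
    congr 1
    funext i
    exact i.elim0
  | succ n ih =>
    intro G c hG hd hp
    set ν : Measure ℝ := (volume : Measure ℝ).restrict (Set.Icc (0:ℝ) (2 * Real.pi)) with hν
    -- peel off coordinate `0`
    have hmp : MeasurePreserving (MeasurableEquiv.piFinSuccAbove (fun _ : Fin (n + 1) => ℝ) 0)
        (Measure.pi fun _ => ν) (ν.prod (Measure.pi fun _ : Fin n => ν)) :=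
      measurePreserving_piFinSuccAbove (fun _ => ν) 0
    have key : ∀ c' : Fin (n + 1) → ℂ,
        ∫ θ, G (fun i => (θ i : ℂ) + c' i) ∂(Measure.pi fun _ => ν) =
          ∫ p : ℝ × (Fin n → ℝ), G (Fin.cons ((p.1 : ℂ) + c' 0) (fun j => (p.2 j : ℂ) + c' j.succ))
            ∂(ν.prod (Measure.pi fun _ : Fin n => ν)) := by
      intro c'
      rw [← hmp.integral_comp']
      congr 1
      funext θ
      simp only [MeasurableEquiv.piFinSuccAbove_apply]
      exact congrArg G (Fin.cons_self_tail (fun i => (θ i : ℂ) + c' i)).symm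
    -- data of the sections `w ↦ G (Fin.cons t w)` (induction hypothesis) ...
    have hGt_cont : ∀ t : ℂ, Continuous fun w : Fin n → ℂ => G (Fin.cons t w) := fun t => by
      fun_prop
    have hGt_d : ∀ (t : ℂ) (z : Fin n → ℂ) (i : Fin n),
        Differentiable ℂ (fun s : ℂ => G (Fin.cons t (Function.update z i s))) := by
      intro t z i
      simp_rw [Fin.cons_update]
      exact hd _ _
    have hGt_p : ∀ (t : ℂ) (z : Fin n → ℂ) (i : Fin n),
        G (Fin.cons t (Function.update z i (z i + 2 * Real.pi))) = G (Fin.cons t z) := by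
      intro t z i
      rw [Fin.cons_update]
      have := hp (Fin.cons t z) i.succ
      rwa [Fin.cons_succ] at this
    -- ... and of the sections `s ↦ G (Fin.cons s w)` (one-variable lemma)
    have h1_d : ∀ w : Fin n → ℂ, Differentiable ℂ (fun s : ℂ => G (Fin.cons s w)) := by
      intro w
      have := hd (Fin.cons 0 w) 0
      simp_rw [Fin.update_cons_zero] at this
      exact this
    have h1_p : ∀ (w : Fin n → ℂ) (s : ℂ), G (Fin.cons (s + 2 * Real.pi) w) = G (Fin.cons s w) := by
      intro w s
      have := hp (Fin.cons s w) 0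
      rwa [Fin.cons_zero, Fin.update_cons_zero] at this
    have key0 := key 0
    simp only [Pi.zero_apply, add_zero] at key0
    rw [key c, key0]
    calc ∫ p : ℝ × (Fin n → ℝ), G (Fin.cons ((p.1 : ℂ) + c 0) (fun j => (p.2 j : ℂ) + c j.succ))
            ∂(ν.prod (Measure.pi fun _ : Fin n => ν))
        = ∫ t, ∫ w, G (Fin.cons ((t : ℂ) + c 0) (fun j => (w j : ℂ) + c j.succ))
            ∂(Measure.pi fun _ : Fin n => ν) ∂ν :=
          integral_prod _ (integrable_prod_pi_Icc_of_continuous (by fun_prop))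
      _ = ∫ t, ∫ w, G (Fin.cons ((t : ℂ) + c 0) (fun j => (w j : ℂ)))
            ∂(Measure.pi fun _ : Fin n => ν) ∂ν := by
          congr 1
          funext t
          exact ih (fun w => G (Fin.cons ((t : ℂ) + c 0) w)) (fun j => c j.succ) (hGt_cont _)
            (hGt_d _) (hGt_p _)
      _ = ∫ w, ∫ t, G (Fin.cons ((t : ℂ) + c 0) (fun j => (w j : ℂ)))
            ∂ν ∂(Measure.pi fun _ : Fin n => ν) :=
          integral_integral_swap (integrable_prod_pi_Icc_of_continuous (by fun_prop))
      _ = ∫ w, ∫ t, G (Fin.cons (t : ℂ) (fun j => (w j : ℂ)))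
            ∂ν ∂(Measure.pi fun _ : Fin n => ν) := by
          congr 1
          funext w
          exact setIntegral_Icc_comp_add_of_periodic_entire (fun s => G (Fin.cons s fun j => (w j : ℂ)))
            (h1_d _) (h1_p _) (c 0)
      _ = ∫ t, ∫ w, G (Fin.cons (t : ℂ) (fun j => (w j : ℂ)))
            ∂(Measure.pi fun _ : Fin n => ν) ∂ν :=
          (integral_integral_swap (f := fun (t : ℝ) (w : Fin n → ℝ) => G (Fin.cons (t : ℂ) fun j => (w j : ℂ)))
            (integrable_prod_pi_Icc_of_continuous (by fun_prop))).symm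
      _ = ∫ p : ℝ × (Fin n → ℝ), G (Fin.cons (p.1 : ℂ) (fun j => (p.2 j : ℂ)))
            ∂(ν.prod (Measure.pi fun _ : Fin n => ν)) :=
          (integral_prod (fun p : ℝ × (Fin n → ℝ) => G (Fin.cons (p.1 : ℂ) fun j => (p.2 j : ℂ)))
            (integrable_prod_pi_Icc_of_continuous (by fun_prop))).symm

/-! ### Many variables indexed by a finite type -/

/-- ITERATED CONTOUR SHIFT on `[0,2π]^ι` for a finite index type `ι` (product-measure form).  For
`G : ℂ^ι → ℂ` continuous, entire in each coordinate separately and `2π`-periodic in each coordinate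
separately, `∫_{[0,2π]^ι} G(θ + c) dθ = ∫_{[0,2π]^ι} G(θ) dθ` for every complex shift vector `c`
(transport to `Fin (card ι)` along `MeasurableEquiv.piCongrLeft`). -/
theorem integral_pi_Icc_comp_add_complex {ι : Type*} [Fintype ι] [DecidableEq ι]
    (G : (ι → ℂ) → ℂ) (c : ι → ℂ) (hG : Continuous G)
    (hd : ∀ (z : ι → ℂ) (i : ι), Differentiable ℂ (fun t : ℂ => G (Function.update z i t)))
    (hp : ∀ (z : ι → ℂ) (i : ι), G (Function.update z i (z i + 2 * Real.pi)) = G z) :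
    ∫ θ, G (fun i => (θ i : ℂ) + c i)
        ∂(Measure.pi fun _ : ι => (volume : Measure ℝ).restrict (Set.Icc (0:ℝ) (2 * Real.pi))) =
      ∫ θ, G (fun i => (θ i : ℂ))
        ∂(Measure.pi fun _ : ι => (volume : Measure ℝ).restrict (Set.Icc (0:ℝ) (2 * Real.pi))) := by
  set ν : Measure ℝ := (volume : Measure ℝ).restrict (Set.Icc (0:ℝ) (2 * Real.pi)) with hν
  set e : Fin (Fintype.card ι) ≃ ι := (Fintype.equivFin ι).symm with he
  have hmp : MeasurePreserving (MeasurableEquiv.piCongrLeft (fun _ : ι => ℝ) e).symm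
      (Measure.pi fun _ : ι => ν) (Measure.pi fun _ : Fin (Fintype.card ι) => ν) :=
    (measurePreserving_piCongrLeft (fun _ : ι => ν) e).symm _
  have happ : ∀ (θ : ι → ℝ) (k : Fin (Fintype.card ι)),
      (MeasurableEquiv.piCongrLeft (fun _ : ι => ℝ) e).symm θ k = θ (e k) := by
    intro θ k
    have h1 := MeasurableEquiv.piCongrLeft_apply_apply e (β := fun _ : ι => ℝ)
      ((MeasurableEquiv.piCongrLeft (fun _ : ι => ℝ) e).symm θ) k
    rwa [MeasurableEquiv.apply_symm_apply] at h1
  -- the flattened integrand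
  set Gf : (Fin (Fintype.card ι) → ℂ) → ℂ := fun w => G (fun a => w (e.symm a)) with hGf
  have hGf_cont : Continuous Gf := hG.comp (continuous_pi fun a => continuous_apply (e.symm a))
  have hGf_upd : ∀ (w : Fin (Fintype.card ι) → ℂ) (k : Fin (Fintype.card ι)) (t : ℂ),
      Gf (Function.update w k t) = G (Function.update (w ∘ e.symm) (e.symm.symm k) t) := by
    intro w k t
    simp only [hGf]
    rw [← Function.update_comp_equiv w e.symm k t]
    rfl
  have hGf_d : ∀ (w : Fin (Fintype.card ι) → ℂ) (k : Fin (Fintype.card ι)),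
      Differentiable ℂ (fun t : ℂ => Gf (Function.update w k t)) := by
    intro w k
    simp_rw [hGf_upd]
    exact hd _ _
  have hGf_p : ∀ (w : Fin (Fintype.card ι) → ℂ) (k : Fin (Fintype.card ι)),
      Gf (Function.update w k (w k + 2 * Real.pi)) = Gf w := by
    intro w k
    rw [hGf_upd]
    have h1 : w k = (w ∘ e.symm) (e.symm.symm k) := by simp
    rw [h1, hp]
    rfl
  have key : ∀ c' : ι → ℂ, ∫ θ, G (fun i => (θ i : ℂ) + c' i) ∂(Measure.pi fun _ : ι => ν) =
      ∫ w, Gf (fun k => (w k : ℂ) + c' (e k)) ∂(Measure.pi fun _ : Fin (Fintype.card ι) => ν) := by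
    intro c'
    rw [← hmp.integral_comp']
    congr 1
    funext θ
    simp only [hGf, happ, Equiv.apply_symm_apply]
  have key0 := key 0
  simp only [Pi.zero_apply, add_zero] at key0
  rw [key c, key0]
  exact integral_pi_Icc_comp_add_complex_fin _ Gf (fun k => c (e k)) hGf_cont hGf_d hGf_p

/-- ITERATED CONTOUR SHIFT on `[0,2π]^ι`, set-integral form: for `G : ℂ^ι → ℂ` continuous, entire in
each coordinate separately and `2π`-periodic in each coordinate separately, the Lebesgue integral of
`θ ↦ G θ` over the cube `Set.pi univ (fun _ ↦ Icc 0 (2π))` is invariant under every complex translation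
`c : ι → ℂ` of the coordinates. -/
theorem setIntegral_pi_Icc_comp_add_complex {ι : Type*} [Fintype ι] [DecidableEq ι]
    (G : (ι → ℂ) → ℂ) (c : ι → ℂ) (hG : Continuous G)
    (hd : ∀ (z : ι → ℂ) (i : ι), Differentiable ℂ (fun t : ℂ => G (Function.update z i t)))
    (hp : ∀ (z : ι → ℂ) (i : ι), G (Function.update z i (z i + 2 * Real.pi)) = G z) :
    MeasureTheory.integral
        (MeasureTheory.volume.restrict (Set.pi Set.univ fun _ : ι => Set.Icc (0:ℝ) (2 * Real.pi)))
        (fun θ => G (fun i => (θ i : ℂ) + c i)) =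
      MeasureTheory.integral
        (MeasureTheory.volume.restrict (Set.pi Set.univ fun _ : ι => Set.Icc (0:ℝ) (2 * Real.pi)))
        (fun θ => G (fun i => (θ i : ℂ))) := by
  rw [← pi_restrict_Icc_eq_restrict_pi]
  exact integral_pi_Icc_comp_add_complex G c hG hd hp

/-- S2a-i of line `theta-rotor-equimodular-zeros` (registered stub signature): ITERATED CONTOUR SHIFT ON
THE TORUS `[0,2π]^Λ` — for an integrand that is continuous on `ℂ^Λ`, entire in each coordinate
separately and `2π`-periodic in each coordinate, the integral over the real cube `cube L M` is invariant
under translating every coordinate by an arbitrary complex constant. -/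
theorem stub_cube_contour_shift :
    ∀ (L M : ℕ) [NeZero L] [NeZero M],
      (∀ (G : (Λ L M → ℂ) → ℂ) (c : Λ L M → ℂ), Continuous G →
        (∀ (z : Λ L M → ℂ) (s : Λ L M), Differentiable ℂ (fun t : ℂ => G (Function.update z s t))) →
        (∀ (z : Λ L M → ℂ) (s : Λ L M), G (Function.update z s (z s + 2 * Real.pi)) = G z) →
        MeasureTheory.integral (MeasureTheory.volume.restrict (cube L M))
            (fun θ => G (fun s => (θ s : ℂ) + c s)) =
          MeasureTheory.integral (MeasureTheory.volume.restrict (cube L M))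
            (fun θ => G (fun s => (θ s : ℂ)))) :=
  fun _ _ _ _ G c hG hd hp => setIntegral_pi_Icc_comp_add_complex G c hG hd hp

end

end Summit.HubbardSuperconductivity.BirComplexStableXYNegative
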